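import Literature.NumberTheory.EllipticCurves.BSDQuadraticDescent
import HarnessLib

/-!
# The Birch–Swinnerton-Dyer quotient under quadratic base change, in ANY rank and for a
# quadratic field of EITHER signature (Milne 1972, Thm. 1, through Dokchitser–Dokchitser 2010)

Topic `NumberTheory/EllipticCurves`, story `Milne1972` (J. S. Milne, *On the arithmetic of abelian
varieties*, Invent. Math. 17 (1972) 177–190). The tree already vendors the special case needed by
the Burungale–Flach descent — `WeierstrassCurve.bsdRHS_baseChange_quadratic`
(`BSDQuadraticDescent.lean`): `K` IMAGINARY quadratic and the RANK-ZERO shape (`E(K)` finite, all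
regulators `1`). This file states the same published theorem without those two restrictions, in
the tree's Birch–Swinnerton-Dyer vocabulary over a number field (`WeierstrassCurve.bsdPeriod`,
`regulator`, `tamagawaProduct`, `shaOrder`, `torsionOrder` of a globally minimal `K`-model), for
use by the base-change-and-descend route of the BSD rank-`≤ 1` residual cell at additive,
potentially multiplicative primes (`Summits/BirchSwinnertonDyer/Rank1Residual/AdditivePotMult/`),
where `K = ℚ(√D)` may be real and `E`, `E^{(D)}` have analytic rank `≤ 1` each.

The statement. Dokchitser–Dokchitser, Ann. of Math. 172 (2010), §2.1, statement 2.1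
(the Birch–Swinnerton-Dyer formula over a number field, after Tate [35]): for an abelian variety `A/K` with a global exterior form `ω`,
*"the leading coefficient of `L(A/K, s)` at `s = 1` is
`BSD(A/K) = |Ш(A/K)| Reg(A/K) C(A/K) / (|A(K)_tors| |A^t(K)_tors| |Δ_K|^{dim A/2}) ·
∏_{v∣∞ real} ∫_{A(K_v)} |ω| · ∏_{v∣∞ cplx} 2∫_{A(K_v)} ω ∧ ω̄`. Notation. We call `BSD(A/K)` the
Birch–Swinnerton-Dyer quotient for `A/K`"* (their Notation after statement 2.1), with (p. 4) *"`Reg(E/K)` regulator of `E/K`, i.e.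
`|det|` of the canonical height pairing on a basis of `E(K)/E(K)_tors`"* and `C(A/K)` the product
of the Tamagawa numbers corrected by `|ω/ω_v°|_v` (all corrections `1` for a model whose
differential is a Néron differential at every finite place, e.g. a globally minimal model). Loc.
cit., proof of Thm. 2.3: *"For `F/K` finite, write `W_{F/K}(A)` for the Weil restriction of
scalars of `A/F` to `K`. This is an abelian variety over `K` of dimension `[F : K] dim A`, and
`BSD_p(W_{F/K}(A)) = BSD_p(A/F)` provided that `Ш(A/F)[p^∞]` is finite ([24] §1)"* — [24] = Milne
1972, §1, Thm. 1 — and *"the invariance of the Birch–Swinnerton-Dyer quotient under isogenies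
([6], [35] and [25] Thm. 7.3, Remark 7.4)"* (Cassels 1965; Tate; Milne, *ADT* I.7.3). For `K = ℚ`,
`F` a quadratic field of discriminant `D` and `A = E_F` the base change of `E/ℚ`, the Weil
restriction is `ℚ`-isogenous to `E × E^{(D)}` (Milne 1972 §2; Burungale–Flach, Camb. J. Math. 12
(2024), proof of Cor. 2: *"there is an isogeny of abelian surfaces `Res^F_{F⁺}(E/F) ∼ E × E_ε`"*),
the quotient of a product is the product of the quotients, and `Ш` of isogenous abelian varieties
are simultaneously finite (Milne *ADT* I.7.3, proof; `Ш(W_{F/ℚ}(E_F)/ℚ) ≅ Ш(E_F/F)`, Milne 1972 §1).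
Hence, with ALL THREE groups `Ш(E/ℚ)`, `Ш(E^{(D)}/ℚ)`, `Ш(E_F/F)` finite as soon as the first two
are: **`BSD(E_F/F) = BSD(E/ℚ) · BSD(E^{(D)}/ℚ)`**.

Translation (as in `bsdRHS_baseChange_quadratic`, whose docstring records the same chain and the
period normalisation): `W/ℚ` globally minimal, `Wd` a globally minimal `ℚ`-model of the twist
`W.quadraticTwist d_K`, `W'` a globally minimal `K`-model of `W.baseChange K` (so all
`|ω/ω_v°|_v = 1` and `C = ∏ c_v = tamagawaProduct`), `BSD(E_K/K) = #Ш(W') · Reg(W') · bsdPeriod(W')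
· ∏_w c_w(W') / #W'(K)_tors²` with `bsdPeriod W' = (∏_{w∣∞} placePeriod)/|d_K|^{1/2}`
(`ComplexPeriod.lean`: real places `∫|ω|`, complex places `2 dx ∧ dy`, exactly the factors of
statement 2.1), `Reg` on the canonical height RELATIVE to `K` (`Heights.lean`: Mathlib's normalisation,
not divided by `[K : ℚ]` — the normalisation of statement 2.1 / Gross–Zagier), `E ≅ E^t` so
`|A(K)_tors||A^t(K)_tors| = #E(K)_tors²`; over `ℚ` the quotient is `WeierstrassCurve.bsdRHS`.
A named fact (`def … : Prop`), a THEOREM of the cited sources; users take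
`(h : bsdQuotient_baseChange_quadratic)`. The rank-zero imaginary case is being proved piecewise in
`BSDQuadraticDescent*Proofs` (Artin formalism, the archimedean comparison and the odd part of `Ш`
are theorems there).

## References
* J. S. Milne, *On the arithmetic of abelian varieties*, Invent. Math. 17 (1972) 177–190, §1
  Thm. 1 (p. 182); §2 Prop. 6 (a) (p. 183), Prop. 7 (p. 184) and Example 1 (p. 185: "the
  proposition shows there is an isogeny `N_{K̄/K}A → A × A_d` of degree 4" — the Weil-restriction
  isogeny `Res_{K/ℚ} E_K ∼ E × E^{(d)}` used here). [Milne1972ArithmeticAV]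
* T. Dokchitser, V. Dokchitser, *On the Birch–Swinnerton-Dyer quotients modulo squares*, Ann. of
  Math. 172 (2010) 567–596, §2.1: statement 2.1 and Notation (the BSD-quotient), proof of Thm. 2.3. [DokchitserDokchitserAnnals2010]
* A. Burungale, M. Flach, Camb. J. Math. 12 (2024), proof of Cor. 2 and Remark 2. [BurungaleFlach2024]
* J. W. S. Cassels, J. reine angew. Math. 217 (1965); J. S. Milne, *Arithmetic Duality Theorems*,
  2nd ed., Thm. I.7.3, Remark I.7.4. [Cassels1965ArithmeticVIII] [MilneADT2006]
-/

noncomputable section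

open scoped Classical

namespace Literature.NumberTheory.EllipticCurves.Milne1972

open WeierstrassCurve

/-- **Milne 1972, Thm. 1 (Weil restriction) + isogeny invariance, for a quadratic base change, in
any rank: `BSD(E_K/K) = BSD(E/ℚ) · BSD(E^{(d_K)}/ℚ)`.** Dokchitser–Dokchitser, Ann. of Math. 172
(2010), §2.1, proof of Thm. 2.3, verbatim: *"For `F/K` finite, write `W_{F/K}(A)` for the Weil
restriction of scalars of `A/F` to `K`. This is an abelian variety over `K` of dimension
`[F : K] dim A`, and `BSD_p(W_{F/K}(A)) = BSD_p(A/F)` provided that `Ш(A/F)[p^∞]` is finite ([24]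
§1)"* ([24] = Milne, Invent. Math. 17 (1972), §1 Thm. 1), together with *"the invariance of the
Birch–Swinnerton-Dyer quotient under isogenies ([6], [35] and [25] Thm. 7.3, Remark 7.4)"*, the
quotient being that of their §2.1, statement 2.1 (the Birch–Swinnerton-Dyer formula over `K`, after Tate) and Notation: *"`BSD(A/K) = |Ш(A/K)| Reg(A/K) C(A/K) /
(|A(K)_tors||A^t(K)_tors||Δ_K|^{dim A/2}) · ∏_{v real} ∫_{A(K_v)}|ω| · ∏_{v cplx} 2∫_{A(K_v)} ω∧ω̄`"*,
*"`Reg(E/K)` … `|det|` of the canonical height pairing on a basis of `E(K)/E(K)_tors`"*. Applied to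
`k = ℚ`, `F = K` quadratic of discriminant `D = d_K` (real OR imaginary), `A = E_K`: the Weil
restriction is `ℚ`-isogenous to `E × E^{(D)}` (Milne 1972 §2; Burungale–Flach 2024, proof of
Cor. 2: *"there is an isogeny of abelian surfaces `Res^F_{F⁺}(E/F) ∼ E × E_ε`"*), BSD quotients of
products multiply, and finiteness of `Ш` passes along isogenies and the identification
`Ш(Res E_K/ℚ) = Ш(E_K/K)`; so if `Ш(E/ℚ)` and `Ш(E^{(D)}/ℚ)` are finite then `Ш(E_K/K)` is finite and
`#Ш(E_K) · Reg(E_K/K) · Ω(E_K/K) · ∏_w c_w / #E(K)_tors² = RHS(E/ℚ) · RHS(E^{(D)}/ℚ)`.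
Tree translation: `W` globally minimal over `ℚ`; `Wd` a globally minimal `ℚ`-model of
`W.quadraticTwist d_K`; `W'` a globally minimal `K`-model of `W.baseChange K` (Néron differential
at all finite places, so `C(E_K/K) = W'.tamagawaProduct` and `Ω(E_K/K) = W'.bsdPeriod =
∏_{w∣∞} placePeriod / |d_K|^{1/2}`, `ComplexPeriod.lean`); `Reg = W'.regulator` (canonical height
relative to `K`, `Heights.lean`); `RHS = WeierstrassCurve.bsdRHS = #Ш·Reg·Ω·∏c_p/#E(ℚ)_tors²`.
Generalises the tree's `WeierstrassCurve.bsdRHS_baseChange_quadratic` (same source; `K` imaginary,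
`E(K)` finite). [cite: Milne1972ArithmeticAV, §1 Thm. 1; §2 Prop. 6 (a), Prop. 7 and Example 1 (p. 185) (through DokchitserDokchitserAnnals2010, §2.1, proof of Thm. 2.3)]
[cite: DokchitserDokchitserAnnals2010, §2.1: statement 2.1, Notation, proof of Thm. 2.3]
[cite: BurungaleFlach2024, proof of Cor. 2 (arXiv p. 4)] [cite: MilneADT2006, Thm. I.7.3 and Remark I.7.4] -/
def bsdQuotient_baseChange_quadratic : Prop :=
  ∀ (W : WeierstrassCurve ℚ) [W.IsElliptic] [W.IsGloballyMinimal]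
    (K : Type) [Field K] [NumberField K], Module.finrank ℚ K = 2 →
    ∀ (Wd : WeierstrassCurve ℚ) [Wd.IsElliptic] [Wd.IsGloballyMinimal],
      (∃ C : VariableChange ℚ, C • W.quadraticTwist (NumberField.discr K : ℚ) = Wd) →
    ∀ (W' : WeierstrassCurve K) [W'.IsElliptic] [W'.IsGloballyMinimal],
      (∃ C : VariableChange K, C • W.baseChange K = W') →
      W.ShaFinite → Wd.ShaFinite →
        W'.ShaFinite ∧
          (W'.shaOrder : ℝ) * W'.regulator * W'.bsdPeriod * (W'.tamagawaProduct : ℝ) /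
              (W'.torsionOrder : ℝ) ^ 2 =
            W.bsdRHS * Wd.bsdRHS

end Literature.NumberTheory.EllipticCurves.Milne1972

end
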